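import Summits.BirchSwinnertonDyer.Rank1Residual.X11a.PrintEisensteinHalf
import Summits.BirchSwinnertonDyer.Rank1Residual.X11a.PrintHidaMembersTransfer
import HarnessLib

/-!
# Class X11a, PRINT tier, seat p1: road p1 BY NAME, end to end — the Hida-members transfer datum
# (Skinner 2016 §3.1 one-sided) ⟹ the Eisenstein half ⟹ Mazur's main conjecture ⟹ `BSD(E,p)` ⟹
# the body of crux `X11aLowerHalf`, on the surjective sub-leaf `ClassX11a ∧ 5 ≤ p ∧ Surj`

Cell `bsd-print-x11a` (run/shared/lean/pub/bsd-print-x11a/), prover seat p1 («Skinner 2016 Thm C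
variants BY NAME with the ramified-prime hypothesis removed via BCS 2024 base change: type +
discharge»). Fourth file of the seat: pure GLUE by name between `PrintHidaMembersTransfer.lean`
(the shape `HidaMembersTransferAt W p` and the kernel transfer `eisensteinHalf_of_hidaMembersTransferAt`)
and `PrintEisensteinHalf.lean` (the socket `EisensteinHalfAt W p` with
`mazurMainConjectureAt_of_eisensteinHalf`, `bsdp_of_eisensteinHalf`,
`missingLowerBoundAt_of_eisensteinHalf`). HONEST FRAMING: theorems only; nothing asserted; no pair or
class closed; everything is CONDITIONAL on the shape `HidaMembersTransferAt W p`, whose single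
beyond-print conjunct is the members' integral cyclotomic Eisenstein inclusion at good ordinary
level and weight `k_m > 2` without (mult) (road p1's residual; referee R0-1/R0-2: Surj sub-leaf
only); every published input is an explicit NAMED-FACT hypothesis already in the tree (Kato–Wuthrich
A32, Stein–Wuthrich 2013 Thm. 6.1 ×2, Greenberg–Stevens, Gross–Zagier–Kolyvagin, modularity as
`exists_isNewformOf`). No label moves; X11a stays CONSTRUCTION-SHAPED.

The chain, by name: `HidaMembersTransferAt W p` ⟹ `EisensteinHalfAt W p`
(`eisensteinHalfAt_of_hidaMembersTransferAt`) ⟹ [`5 ≤ p`, `p ‖ N`, `ρ̄_{E,p}` onto; A32]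
`X2.MazurMainConjectureAt W p` (`mazurMainConjectureAt_of_hidaMembersTransferAt`) ⟹ [X11a; SW13,
GS, GZK, `hNf`] `BSDp W p` (`bsdp_of_hidaMembersTransferAt`) ⟹ `Typed.MissingLowerBoundAt W p`
(`missingLowerBoundAt_of_hidaMembersTransferAt`, the body of item stmt-BirchSwinnertonDyer-19064
`X11aLowerHalf` at the pair); class-level form `bsdp_of_forall_hidaMembersTransferAt` on the
surjective sub-leaf. Last section: the intended coefficient ring `S = 𝒪⟦T⟧` meets the shape's ring
conditions (`span_C_p_map_le_jacobson_powerSeries`, `mem_span_singleton_of_map_mem_span`) — so the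
shape's abstract-ring clauses are innocuous bookkeeping, not content.

References: [Skinner2016PacificMC] §3.1–3.3; [Wuthrich2014] Thm. 3, Cor. 19; [SteinWuthrich2013]
Thm. 6.1; [Miller2011LMS] Def. 1.1; companion files of this seat.
-/

set_option autoImplicit false

noncomputable section

open scoped Classical MatrixGroups ModularForm

open CongruenceSubgroup WeierstrassCurve Literature.NumberTheory.EllipticCurves
  Literature.NumberTheory.EllipticCurves.ModularForms
  Literature.NumberTheory.EllipticCurves.Rank1Residual
  Literature.NumberTheory.EllipticCurves.Rank1Residual.Typed
  Literature.NumberTheory.EllipticCurves.Wuthrich2014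
  Literature.NumberTheory.EllipticCurves.SteinWuthrich2013

namespace Summit.BirchSwinnertonDyer.Rank1Residual.X11a

variable (W : WeierstrassCurve ℚ) [W.IsElliptic] [W.IsGloballyMinimal] (p : ℕ) [Fact p.Prime]

omit [W.IsElliptic] [W.IsGloballyMinimal] in
/-- **The Hida-members transfer datum gives the Eisenstein half, by name** (Skinner 2016 §3.1 read
one-sidedly: `eisensteinHalf_of_hidaMembersTransferAt` at every datum). [cite: Skinner2016PacificMC, §3.1–3.3 (one-sided reading)] -/
theorem eisensteinHalfAt_of_hidaMembersTransferAt (h : HidaMembersTransferAt W p) :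
    EisensteinHalfAt W p :=
  fun κ γ hκ hγ hγ' _ _ f hf D ϖ hϖ L hL =>
    eisensteinHalf_of_hidaMembersTransferAt W p h κ γ hκ hγ hγ' f hf D ϖ hϖ L hL

/-- **The transfer datum + Kato–Wuthrich A32 ⇒ Mazur's main conjecture at `(E, p)`** for `p ≥ 5`
multiplicative with `ρ̄_{E,p}` onto. [cite: Skinner2016PacificMC, §3.1–3.3 (one-sided reading)]
[cite: Wuthrich2014, Thm. 3 and Cor. 19] -/
theorem mazurMainConjectureAt_of_hidaMembersTransferAt
    (hKato : kato_charIdeal_dvd_multiplicative_of_surjective)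
    (hp : 5 ≤ p) (hmult : W.HasMultiplicativeReductionAtPrime p) (hsurj : Surj W p)
    (h : HidaMembersTransferAt W p) : X2.MazurMainConjectureAt W p :=
  mazurMainConjectureAt_of_eisensteinHalf W p hKato hp hmult hsurj
    (eisensteinHalfAt_of_hidaMembersTransferAt W p h)

/-- **Road p1 at a pair: the transfer datum ⇒ `BSD(E,p)`** on class X11a at `p ≥ 5` with
`ρ̄_{E,p}` onto (PUBLISHED named facts: A32, Stein–Wuthrich 2013 Thm. 6.1 ×2, Greenberg–Stevens,
GZK, modularity `hNf`). [cite: SteinWuthrich2013, Thm. 6.1 (p. 20)] [cite: Wuthrich2014, Thm. 3 and Cor. 19] -/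
theorem bsdp_of_hidaMembersTransferAt (hNf : exists_isNewformOf)
    (hKato : kato_charIdeal_dvd_multiplicative_of_surjective)
    (hJs : thm61_splitMultiplicative) (hJn : thm61_nonsplitMultiplicative)
    (hGZK : rank_eq_analyticRank_of_analyticRank_le_one)
    (hGS : greenberg_stevens (W := W) (p := p))
    (hX : ClassX11a W p) (hp : 5 ≤ p) (hsurj : Surj W p) (h : HidaMembersTransferAt W p) :
    BSDp W p :=
  bsdp_of_eisensteinHalf W p hNf hKato hJs hJn hGZK hGS hX hp hsurj
    (eisensteinHalfAt_of_hidaMembersTransferAt W p h)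

/-- **Road p1 feeds crux 19064 `X11aLowerHalf` BY NAME on the surjective sub-leaf**: the transfer
datum gives `Typed.MissingLowerBoundAt W p` at an X11a pair with `p ≥ 5` and `ρ̄_{E,p}` onto.
[cite: Miller2011LMS, Def. 1.1] [cite: SteinWuthrich2013, Thm. 6.1 (p. 20)] -/
theorem missingLowerBoundAt_of_hidaMembersTransferAt (hNf : exists_isNewformOf)
    (hKato : kato_charIdeal_dvd_multiplicative_of_surjective)
    (hJs : thm61_splitMultiplicative) (hJn : thm61_nonsplitMultiplicative)
    (hGZK : rank_eq_analyticRank_of_analyticRank_le_one)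
    (hGS : greenberg_stevens (W := W) (p := p))
    (hX : ClassX11a W p) (hp : 5 ≤ p) (hsurj : Surj W p) (h : HidaMembersTransferAt W p) :
    MissingLowerBoundAt W p :=
  missingLowerBoundAt_of_eisensteinHalf W p hNf hKato hJs hJn hGZK hGS hX hp hsurj
    (eisensteinHalfAt_of_hidaMembersTransferAt W p h)

/-- **The surjective sub-leaf of X11a from the transfer datum at every such pair** (class-level
form of road p1; CONDITIONAL on the shape at each pair). [cite: SteinWuthrich2013, Thm. 6.1 (p. 20)]
[cite: Wuthrich2014, Thm. 3 and Cor. 19] -/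
theorem bsdp_of_forall_hidaMembersTransferAt (hNf : exists_isNewformOf)
    (hKato : kato_charIdeal_dvd_multiplicative_of_surjective)
    (hJs : thm61_splitMultiplicative) (hJn : thm61_nonsplitMultiplicative)
    (hGZK : rank_eq_analyticRank_of_analyticRank_le_one)
    (hGS : ∀ (W : WeierstrassCurve ℚ) [W.IsElliptic] [W.IsGloballyMinimal] (p : ℕ) [Fact p.Prime],
      greenberg_stevens (W := W) (p := p))
    (h : ∀ (W : WeierstrassCurve ℚ) [W.IsElliptic] [W.IsGloballyMinimal] (p : ℕ) [Fact p.Prime],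
      Leaf W p → Surj W p → HidaMembersTransferAt W p) :
    ∀ (W : WeierstrassCurve ℚ) [W.IsElliptic] [W.IsGloballyMinimal] (p : ℕ) [Fact p.Prime],
      Leaf W p → Surj W p → BSDp W p :=
  fun W _ _ p _ hL hsurj =>
    bsdp_of_hidaMembersTransferAt W p hNf hKato hJs hJn hGZK (hGS W p) hL.classX11a hL.five_le hsurj
      (h W p hL hsurj)

/-! ### The intended coefficient ring `𝒪⟦T⟧` meets the shape's ring conditions

The shape `HidaMembersTransferAt` asks for a Noetherian `S` receiving `Λ = ℤ_p⟦T⟧` along `φ` with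
`φ(p) ∈ Jac(S)` and `φ` reflecting principal divisibility. For the ring Skinner uses, `S = Λ_𝒪 = 𝒪⟦T⟧`
with `𝒪` the integers of a finite extension `L/ℚ_p` and `φ = PowerSeries.map (algebraMap ℤ_p 𝒪)`:
Noetherian is an instance; the two lemmas below discharge the other two conditions from "`𝒪` is local
with `p` a non-unit" and "`ℤ_p → 𝒪` has a `ℤ_p`-linear retraction" (true for such `𝒪`: `𝒪/ℤ_p` is
finitely generated and torsion-free, hence free, so `ℤ_p · 1` is a direct summand — Matsumura,
Thm. 7.5 (ii) ⇒ (i) for the faithfully flat `ℤ_p⟦T⟧ → 𝒪⟦T⟧`). Pure algebra; no number theory. -/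

section CoeffRing

variable {p : ℕ} [Fact p.Prime] {O : Type*} [CommRing O] [Algebra ℤ_[p] O]

/-- **`(p) ↦ Jac(𝒪⟦T⟧)`** for a local `𝒪` in which `p` is not a unit: `𝒪⟦T⟧` is local and the
constant term of `φ(p) = C(p · 1)` is a non-unit. [folklore] -/
theorem span_C_p_map_le_jacobson_powerSeries [IsLocalRing O]
    (hp : ¬ IsUnit (algebraMap ℤ_[p] O (p : ℤ_[p]))) :
    (Ideal.span {(PowerSeries.C (p : ℤ_[p]) : IwasawaAlgebra p)}).map
        (PowerSeries.map (algebraMap ℤ_[p] O)) ≤ (⊥ : Ideal (PowerSeries O)).jacobson := by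
  rw [Ideal.map_span, Set.image_singleton, PowerSeries.map_C,
    IsLocalRing.jacobson_eq_maximalIdeal ⊥ bot_ne_top, Ideal.span_le, Set.singleton_subset_iff]
  intro hu
  have h2 := PowerSeries.isUnit_iff_constantCoeff.mp hu
  rw [PowerSeries.constantCoeff_C] at h2
  exact hp h2

/-- **`Λ → 𝒪⟦T⟧` reflects principal divisibility** when `ℤ_p → 𝒪` admits a `ℤ_p`-linear retraction
`r` (`r ∘ algebraMap = id`): if `φ x = s · φ y` then `x = R(s) · y` for the coefficientwise
retraction `R(s) = ∑ r(s_n) Tⁿ`. (Faithful-flatness descent for principal ideals, made explicit.)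
[folklore] -/
theorem mem_span_singleton_of_map_mem_span (r : O →ₗ[ℤ_[p]] ℤ_[p])
    (hr : ∀ a : ℤ_[p], r (algebraMap ℤ_[p] O a) = a) (x y : IwasawaAlgebra p)
    (h : PowerSeries.map (algebraMap ℤ_[p] O) x ∈
      Ideal.span {PowerSeries.map (algebraMap ℤ_[p] O) y}) :
    x ∈ Ideal.span {y} := by
  obtain ⟨s, hs⟩ := Ideal.mem_span_singleton'.mp h
  refine Ideal.mem_span_singleton'.mpr ⟨PowerSeries.mk fun n => r (PowerSeries.coeff n s), ?_⟩
  ext n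
  have hx : PowerSeries.coeff n x =
      r (PowerSeries.coeff n (PowerSeries.map (algebraMap ℤ_[p] O) x)) := by
    rw [PowerSeries.coeff_map, hr]
  rw [hx, ← hs, PowerSeries.coeff_mul, PowerSeries.coeff_mul, map_sum]
  refine Finset.sum_congr rfl fun ij _ => ?_
  rw [PowerSeries.coeff_mk, PowerSeries.coeff_map, mul_comm (PowerSeries.coeff ij.1 s),
    ← Algebra.smul_def, map_smul, smul_eq_mul, mul_comm]

end CoeffRing

end Summit.BirchSwinnertonDyer.Rank1Residual.X11a

end
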